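import Literature.IUT.HodgeTheaters.PiAvatarThetaNFSlots
import Literature.IUT.HodgeTheaters.PiAvatarBaseKitNFInstances
import Literature.IUT.HodgeTheaters.PiAvatarKitCore
import HarnessLib

/-!
# D-JΘ1-2 (iv-b′) instances: the NF-widened Θ-kit of [IUTchI] §6 AT THE INITIAL Θ-DATA — `baseKitThetaNF` / `placeKitThetaNF` over `V̲`,
# `baseKitThetaNFOfBadPairs CG hS M hA hI B ΛBad` (genuine shape) and `baseKitThetaNFStandIn CG hS M hA hI` (the `X̲→`-stand-in at bad places),
# with (α), (β), Prop 6.6 (ii)(iii) / 6.8 (i) / Ex 6.3 (ii) re-derived and the FROZEN `EvalBinder`/`KitCore`/(γ) corollaries at the NAMED kits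

S. Mochizuki, *Inter-universal Teichmüller theory I*, kurims manuscript (May 2020), Def 6.1 (ii)–(vii) pp. 156–159, Ex 6.3 (i)(ii) p. 161,
Prop 6.6 (ii)(iii) p. 165, Prop 6.7 p. 167, Prop 6.8 (i) p. 167, Ex 4.4 (i)(ii)(iv) pp. 106–107 ([IUTchI] Def 6.1 (ii) p.156)
[claim: Mochizuki2012, status: disputed] (D-0012 claim key, series status DISPUTED — constructions over abc-iut-L5-t2's REAL `InitialThetaData`,
packaging `baseKitThetaNFOfData` (abc-iut-L5-t4 `PiAvatarBaseKitThetaNF`) exactly as `baseKitThetaNF` / `baseKitNFOfBadPairs` / `baseKitNFStandIn`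
(p450281) package `baseKitNFOfData`; nothing of the series is asserted, no side is taken on [IUTchIII] Cor. 3.12).

## What is built
* `baseKitThetaNF B CG hS hsurj hA Λ` / `placeKitThetaNF` (+ `_kit`), (α), (β);
* **`baseKitThetaNFOfBadPairs CG hS M hA hI B ΛBad`** — binders `CG`, `hS`, `M : TorsionMonodromy` (NV #45), `hA`, `hI`, bad-place DATA `B` + laws
  `ΛBad`; (α)(β) + the four §6 consumers;
* **`baseKitThetaNFStandIn CG hS M hA hI`** / `placeKitThetaNFStandIn` «[`X̲→`-profinite stand-in at `v̲ ∈ V̲^bad`]: print's `𝒟_v̲` there is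
  `ℬ^temp(X̳_v̲)⁰`, NOT this kit's `ℬ(Π_{X̲→_v̲})⁰`»; (α)(β) + the four §6 consumers; `baseKitThetaNFStandIn_model_obj`;
* §Slots: `evalBinderThetaNFOfBadPairs` / `evalBinderThetaNFStandIn` (the FROZEN `EvalBinder` at the NAMED Θ-NF-kits from evaluation-section
  binders `ES` at their bad local data), `nonempty_kitCore_baseKitThetaNFOfBadPairs` / `…StandIn`, `thetaAgrees_baseKitThetaNFOfBadPairs` /
  `…StandIn` (law (γ)) — the decls a certificate may NAME (RULINGS #86 (1) CERT consequence), binders displayed: `ES`, `N`, `B`, `hl5`, `hba`, `hb`.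
No instance (the `Normal` instance comes from `M` by `haveI`), no notation; typed ≠ inhabited ≠ proved; binders ≠ facts; NON-VACUITY of the
§Slots decls = that of `ES` (row «EVALSECT-NV») and of `N` (abc-iut-L5-t3 file (D)).
-/

noncomputable section

namespace Literature.IUT.HodgeTheaters

open CategoryTheory

universe u v w

section BaseKitThetaNFInstances

variable {F : Type u} {K : Type v} {Fbar : Type w} [Field F] [NumberField F] [Field K] [NumberField K]
  [Algebra F K] [Field Fbar] [Algebra F Fbar] [Algebra K Fbar]
  {E : WeierstrassCurve F} [E.IsElliptic] {l : ℕ} {Pb : BadPlacePredicates K}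
  (D : InitialThetaData F K Fbar E l Pb)

namespace InitialThetaData

/-! ### The Θ-NF kit over `V̲` -/

section OverPlaces

variable (B : ∀ v, v ∈ D.indexCopyBad → D.BadPairAt v) (CG : D.geom.pe.CuspGalois) (hS : D.CuspClassesNormaliserStable) [Fact l.Prime]
  [(D.PiXund.subgroupOf D.PiXK).Normal] (hsurj : Function.Surjective D.toFlStarGlobal) (hA : D.geom.pe.ArrowCoveringClaims)
  (Λ : ∀ v, D.LocalArrowLaw CG hS (D.localGroupAt B v))

open Classical in
/-- **The NF-widened Θ- Θ-kit of the initial Θ-data over `V̲`** (`baseKitThetaNFOfData` at `localDatumAt`; cf. `baseKitNF`, p450281).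
([IUTchI] Def 6.1 (ii)-(vii) pp.156-159) [claim: Mochizuki2012, status: disputed] -/
def baseKitThetaNF : PMBaseKit.{w} l :=
  D.baseKitThetaNFOfData CG hS hsurj D.indexCopyBad D.indexCopyArc (D.localDatumAt B CG hS hA Λ)

open Classical in
/-- The NF-widened Θ-PLACE KIT over `V̲` (its kit is `baseKitThetaNF`). ([IUTchI] Def 3.1 (e) p.62) [claim: Mochizuki2012, status: disputed] -/
def placeKitThetaNF : PlaceKit.{w} D where
  kit := D.baseKitThetaNF B CG hS hsurj hA Λ
  e := D.indexCopyEquiv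
  mem_bad_iff := D.mem_indexCopyBad_iff
  mem_arc_iff := D.mem_indexCopyArc_iff

/-- Its kit is `baseKitThetaNF`. ([IUTchI] Def 6.1 (ii) p.156) [claim: Mochizuki2012, status: disputed] -/
theorem placeKitThetaNF_kit : (D.placeKitThetaNF B CG hS hsurj hA Λ).kit = D.baseKitThetaNF B CG hS hsurj hA Λ := rfl

open Classical in
/-- **(α)** at `baseKitThetaNF`. ([IUTchI] Ex 6.3 (i) p.161) [claim: Mochizuki2012, status: disputed] -/
theorem phiEllSync_baseKitThetaNF : PMBaseKit.Ex63.PhiEllSync (D.baseKitThetaNF B CG hS hsurj hA Λ) :=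
  D.phiEllSync_baseKitThetaNFOfData CG hS hsurj _ _ _

open Classical in
/-- **(β)** at `baseKitThetaNF`. ([IUTchI] Ex 6.3 (ii) p.161) [claim: Mochizuki2012, status: disputed] -/
theorem negCompatModel_baseKitThetaNF : PMBaseKit.Ex63.NegCompatModel (D.baseKitThetaNF B CG hS hsurj hA Λ) :=
  D.negCompatModel_baseKitThetaNFOfData CG hS hsurj _ _ _

end OverPlaces

/-! ### The genuine-shape Θ-NF kit from a torsion monodromy -/

variable (CG : D.geom.pe.CuspGalois) (hS : D.CuspClassesNormaliserStable) [Fact l.Prime]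
  (M : D.TorsionMonodromy) (hA : D.geom.pe.ArrowCoveringClaims)
  (hI : ∀ k ∈ D.geom.pe.inertia D.geom.pe.ε1, M.tau (D.geom.embK k) = 0)

section Genuine

variable (B : ∀ v, v ∈ D.indexCopyBad → D.BadPairAt v) (ΛBad : ∀ v (h : v ∈ D.indexCopyBad), D.LocalArrowLaw CG hS (B v h).H)

/-- **THE GENUINE-SHAPE Θ-NF KIT**: `baseKitThetaNF` with `[Normal]`/`hsurj` from `M`, the good-place laws d5's THEOREMS ((L1) from `M`, `hA`, `hI`;
(L2) from `hA`), the bad-place DATA `B` with its laws `ΛBad`. ([IUTchI] Def 6.1 (ii)-(vii) pp.156-159) [claim: Mochizuki2012, status: disputed] -/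
def baseKitThetaNFOfBadPairs : PMBaseKit.{w} l :=
  haveI := M.normal_PiXund_subgroupOf_PiXK
  D.baseKitThetaNF B CG hS (D.toFlStarGlobal_surjective_of_torsionMonodromy M) hA
    (D.localArrowLawFamilyOfTorsionMonodromy CG hS M hA hI B
      (fun v _ => D.localArrowLaw_L2_sign_local CG hS hA (D.decompAt v)) ΛBad)

/-- **(α)** at `baseKitThetaNFOfBadPairs`. ([IUTchI] Ex 6.3 (i) p.161) [claim: Mochizuki2012, status: disputed] -/
theorem phiEllSync_baseKitThetaNFOfBadPairs : PMBaseKit.Ex63.PhiEllSync (D.baseKitThetaNFOfBadPairs CG hS M hA hI B ΛBad) := by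
  haveI := M.normal_PiXund_subgroupOf_PiXK
  exact D.phiEllSync_baseKitThetaNF B CG hS _ hA _

/-- **(β)** at `baseKitThetaNFOfBadPairs`. ([IUTchI] Ex 6.3 (ii) p.161) [claim: Mochizuki2012, status: disputed] -/
theorem negCompatModel_baseKitThetaNFOfBadPairs : PMBaseKit.Ex63.NegCompatModel (D.baseKitThetaNFOfBadPairs CG hS M hA hI B ΛBad) := by
  haveI := M.normal_PiXund_subgroupOf_PiXK
  exact D.negCompatModel_baseKitThetaNF B CG hS _ hA _

/-- **[IUTchI] Prop 6.6 (ii)** at `baseKitThetaNFOfBadPairs`. ([IUTchI] Prop 6.6 (ii) p.165) [claim: Mochizuki2012, status: disputed] -/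
theorem isoTorsor_thetaEllBridge_baseKitThetaNFOfBadPairs (B₁ B₂ : (D.baseKitThetaNFOfBadPairs CG hS M hA hI B ΛBad).DThetaEllBridge) :
    PMBaseKit.DThetaEllBridge.IsoTorsor B₁ B₂ :=
  PMBaseKit.DThetaEllBridge.isoTorsor_of_negCompatModel (D.negCompatModel_baseKitThetaNFOfBadPairs CG hS M hA hI B ΛBad) B₁ B₂

/-- **[IUTchI] Prop 6.6 (iii)** at `baseKitThetaNFOfBadPairs`. ([IUTchI] Prop 6.6 (iii) p.165) [claim: Mochizuki2012, status: disputed] -/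
theorem isoTorsor_thetaPMEllHT_baseKitThetaNFOfBadPairs (H₁ H₂ : (D.baseKitThetaNFOfBadPairs CG hS M hA hI B ΛBad).DThetaPMEllHT) :
    PMBaseKit.DThetaPMEllHT.IsoTorsor H₁ H₂ :=
  PMBaseKit.DThetaPMEllHT.isoTorsor_of_negCompatModel (D.negCompatModel_baseKitThetaNFOfBadPairs CG hS M hA hI B ΛBad) H₁ H₂

/-- **[IUTchI] Prop 6.8 (i)** at `baseKitThetaNFOfBadPairs`. ([IUTchI] Prop 6.8 (i) p.167) [claim: Mochizuki2012, status: disputed] -/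
theorem ellBridgeSymmetry_baseKitThetaNFOfBadPairs (H : (D.baseKitThetaNFOfBadPairs CG hS M hA hI B ΛBad).DThetaPMEllHT) :
    PMBaseKit.DThetaPMEllHT.EllBridgeSymmetry H :=
  PMBaseKit.DThetaPMEllHT.ellBridgeSymmetry_of_negCompatModel (D.negCompatModel_baseKitThetaNFOfBadPairs CG hS M hA hI B ΛBad) H

/-- **[IUTchI] Ex 6.3 (ii)** (negative `γ`) at `baseKitThetaNFOfBadPairs`. ([IUTchI] Ex 6.3 (ii) p.161) [claim: Mochizuki2012, status: disputed] -/
theorem equivariant_baseKitThetaNFOfBadPairs {γ : FlPM l} (hγ : γ.IsNegative) :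
    PMBaseKit.Ex63.Equivariant (D.baseKitThetaNFOfBadPairs CG hS M hA hI B ΛBad) γ :=
  (D.negCompatModel_baseKitThetaNFOfBadPairs CG hS M hA hI B ΛBad).equivariant hγ

end Genuine

/-! ### The Θ-NF kit at the `X̲→`-stand-in: binders {`CG`, `hS`, `M`, `hA`, `hI`} -/

/-- **THE Θ-NF STAND-IN KIT** — `baseKitThetaNFOfBadPairs` at `B := badPairAtArrow hA` with the bad-index laws d5's `localArrowLaw_local_of_torsionMonodromy`
(the `X̲→`-recipe law). «[`X̲→`-profinite stand-in at `v̲ ∈ V̲^bad`]»: NOT print's tempered `ℬ^temp(X̳_v̲)⁰`.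
([IUTchI] Def 6.1 (ii)-(vii) pp.156-159) [claim: Mochizuki2012, status: disputed] -/
def baseKitThetaNFStandIn : PMBaseKit.{w} l :=
  D.baseKitThetaNFOfBadPairs CG hS M hA hI (fun v _ => D.badPairAtArrow hA v)
    (fun v _ => D.localArrowLaw_local_of_torsionMonodromy CG hS M hA hI (D.decompAt v))

open Classical in
/-- The Θ-NF stand-in PLACE KIT over `V̲`. ([IUTchI] Def 3.1 (e) p.62) [claim: Mochizuki2012, status: disputed] -/
def placeKitThetaNFStandIn : PlaceKit.{w} D where
  kit := D.baseKitThetaNFStandIn CG hS M hA hI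
  e := D.indexCopyEquiv
  mem_bad_iff := D.mem_indexCopyBad_iff
  mem_arc_iff := D.mem_indexCopyArc_iff

/-- Its kit is `baseKitThetaNFStandIn`. ([IUTchI] Def 6.1 (ii) p.156) [claim: Mochizuki2012, status: disputed] -/
theorem placeKitThetaNFStandIn_kit : (D.placeKitThetaNFStandIn CG hS M hA hI).kit = D.baseKitThetaNFStandIn CG hS M hA hI := rfl

/-- The ambient of the Θ-NF stand-in kit at an index is the NF-widened Θ-ambient `AmbThetaNF` of its local datum (J-NF-1 + (iv-b′)).
([IUTchI] Def 6.1 (vii) p.159) [claim: Mochizuki2012, status: disputed] -/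
theorem baseKitThetaNFStandIn_Amb (v : D.IndexCopy) :
    (D.baseKitThetaNFStandIn CG hS M hA hI).Amb v =
      (D.localDatumAt (fun v _ => D.badPairAtArrow hA v) CG hS hA
        (D.localArrowLawFamilyOfTorsionMonodromy CG hS M hA hI (fun v _ => D.badPairAtArrow hA v)
          (fun v _ => D.localArrowLaw_L2_sign_local CG hS hA (D.decompAt v))
          (fun v _ => D.localArrowLaw_local_of_torsionMonodromy CG hS M hA hI (D.decompAt v))) v).AmbThetaNF := rfl

/-- The local group of the Θ-NF stand-in kit at EVERY index is `Π_{X̲→_K} ∩ augGF⁻¹ G_v̲`. ([IUTchI] Def 3.1 (f) p.63) [claim: Mochizuki2012, status: disputed] -/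
theorem baseKitThetaNFStandIn_model_obj (v : D.IndexCopy) :
    ((D.baseKitThetaNFStandIn CG hS M hA hI).model v).toFull.obj = OrbitCat.of (D.PiXarrow ⊓ (D.decompAt v).comap D.augGF) := by
  change (D.localDatumAt (fun v _ => D.badPairAtArrow hA v) CG hS hA _ v).locObj = _
  rw [LocalDatum.locObj, D.localDatumAt_H, D.localGroupAt_badPairAtArrow]

/-- **(α)** at `baseKitThetaNFStandIn`. ([IUTchI] Ex 6.3 (i) p.161) [claim: Mochizuki2012, status: disputed] -/
theorem phiEllSync_baseKitThetaNFStandIn : PMBaseKit.Ex63.PhiEllSync (D.baseKitThetaNFStandIn CG hS M hA hI) :=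
  D.phiEllSync_baseKitThetaNFOfBadPairs CG hS M hA hI _ _

/-- **(β)** at `baseKitThetaNFStandIn`. ([IUTchI] Ex 6.3 (ii) p.161) [claim: Mochizuki2012, status: disputed] -/
theorem negCompatModel_baseKitThetaNFStandIn : PMBaseKit.Ex63.NegCompatModel (D.baseKitThetaNFStandIn CG hS M hA hI) :=
  D.negCompatModel_baseKitThetaNFOfBadPairs CG hS M hA hI _ _

/-- **[IUTchI] Prop 6.6 (ii)** at `baseKitThetaNFStandIn`. ([IUTchI] Prop 6.6 (ii) p.165) [claim: Mochizuki2012, status: disputed] -/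
theorem isoTorsor_thetaEllBridge_baseKitThetaNFStandIn (B₁ B₂ : (D.baseKitThetaNFStandIn CG hS M hA hI).DThetaEllBridge) :
    PMBaseKit.DThetaEllBridge.IsoTorsor B₁ B₂ :=
  PMBaseKit.DThetaEllBridge.isoTorsor_of_negCompatModel (D.negCompatModel_baseKitThetaNFStandIn CG hS M hA hI) B₁ B₂

/-- **[IUTchI] Prop 6.6 (iii)** at `baseKitThetaNFStandIn`. ([IUTchI] Prop 6.6 (iii) p.165) [claim: Mochizuki2012, status: disputed] -/
theorem isoTorsor_thetaPMEllHT_baseKitThetaNFStandIn (H₁ H₂ : (D.baseKitThetaNFStandIn CG hS M hA hI).DThetaPMEllHT) :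
    PMBaseKit.DThetaPMEllHT.IsoTorsor H₁ H₂ :=
  PMBaseKit.DThetaPMEllHT.isoTorsor_of_negCompatModel (D.negCompatModel_baseKitThetaNFStandIn CG hS M hA hI) H₁ H₂

/-- **[IUTchI] Prop 6.8 (i)** at `baseKitThetaNFStandIn`. ([IUTchI] Prop 6.8 (i) p.167) [claim: Mochizuki2012, status: disputed] -/
theorem ellBridgeSymmetry_baseKitThetaNFStandIn (H : (D.baseKitThetaNFStandIn CG hS M hA hI).DThetaPMEllHT) :
    PMBaseKit.DThetaPMEllHT.EllBridgeSymmetry H :=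
  PMBaseKit.DThetaPMEllHT.ellBridgeSymmetry_of_negCompatModel (D.negCompatModel_baseKitThetaNFStandIn CG hS M hA hI) H

/-- **[IUTchI] Ex 6.3 (ii)** (negative `γ`) at `baseKitThetaNFStandIn`. ([IUTchI] Ex 6.3 (ii) p.161) [claim: Mochizuki2012, status: disputed] -/
theorem equivariant_baseKitThetaNFStandIn {γ : FlPM l} (hγ : γ.IsNegative) :
    PMBaseKit.Ex63.Equivariant (D.baseKitThetaNFStandIn CG hS M hA hI) γ :=
  (D.negCompatModel_baseKitThetaNFStandIn CG hS M hA hI).equivariant hγ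

/-! ### §Slots. The FROZEN `EvalBinder` / `KitCore` / law (γ) at the NAMED Θ-NF-kits (the decls a certificate may NAME) -/

section Slots

variable (B : ∀ v, v ∈ D.indexCopyBad → D.BadPairAt v) (ΛBad : ∀ v (h : v ∈ D.indexCopyBad), D.LocalArrowLaw CG hS (B v h).H)
  (hl5 : 5 ≤ l)

/-- The local data of the genuine-shape Θ-NF-kit (`localDatumAt` at the law family from `M`). ([IUTchI] Def 6.1 (ii) p.156) [claim: Mochizuki2012, status: disputed] -/
abbrev localDataOfBadPairs (v : D.IndexCopy) : D.LocalDatum CG hS :=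
  D.localDatumAt B CG hS hA
    (D.localArrowLawFamilyOfTorsionMonodromy CG hS M hA hI B
      (fun v _ => D.localArrowLaw_L2_sign_local CG hS hA (D.decompAt v)) ΛBad) v

open Classical in
/-- The genuine-shape Θ-NF-kit IS `baseKitThetaNFOfData` at `localDataOfBadPairs` (definitional). ([IUTchI] Def 6.1 (ii) p.156) [claim: Mochizuki2012, status: disputed] -/
theorem baseKitThetaNFOfBadPairs_eq :
    D.baseKitThetaNFOfBadPairs CG hS M hA hI B ΛBad =
      (haveI := M.normal_PiXund_subgroupOf_PiXK
       D.baseKitThetaNFOfData CG hS (D.toFlStarGlobal_surjective_of_torsionMonodromy M) D.indexCopyBad D.indexCopyArc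
        (D.localDataOfBadPairs CG hS M hA hI B ΛBad)) :=
  rfl

variable {Gv : D.IndexCopy → Subgroup (Fbar ≃ₐ[F] Fbar)}
  (ES : ∀ v, v ∈ D.indexCopyBad → EvalSectionBinder (D.localDataOfBadPairs CG hS M hA hI B ΛBad v) (Gv v))

open Classical in
/-- **The multiplicative kit of `baseKitThetaNFOfBadPairs` generated by evaluation sections** (FROZEN `MultKit` shape). ([IUTchI] Prop 6.7 p.167) [claim: Mochizuki2012, status: disputed] -/
def multKitThetaNFOfBadPairs : (D.baseKitThetaNFOfBadPairs CG hS M hA hI B ΛBad).MultKit :=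
  haveI := M.normal_PiXund_subgroupOf_PiXK
  D.multKitThetaNF (D.toFlStarGlobal_surjective_of_torsionMonodromy M) D.indexCopyBad D.indexCopyArc
    (D.localDataOfBadPairs CG hS M hA hI B ΛBad) ES

open Classical in
/-- **The FROZEN `EvalBinder` at `baseKitThetaNFOfBadPairs`, INHABITED from `ES`.** ([IUTchI] Ex 4.4 (i) p.106) [claim: Mochizuki2012, status: disputed] -/
def evalBinderThetaNFOfBadPairs : (D.baseKitThetaNFOfBadPairs CG hS M hA hI B ΛBad).EvalBinder :=
  haveI := M.normal_PiXund_subgroupOf_PiXK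
  D.evalBinderThetaNF (D.toFlStarGlobal_surjective_of_torsionMonodromy M) D.indexCopyBad D.indexCopyArc
    (D.localDataOfBadPairs CG hS M hA hI B ΛBad) ES hl5

variable (N : (D.baseKitThetaNFOfBadPairs CG hS M hA hI B ΛBad).NFKit) (B' : (D.baseKitThetaNFOfBadPairs CG hS M hA hI B ΛBad).MonoBinder)

/-- **The FROZEN `KitCore` at `baseKitThetaNFOfBadPairs` is INHABITED** (identity dictionary over the §4 datum built from the kit); the place inputs
`bad ∩ arc = ∅`, `bad ≠ ∅` are THEOREMS on the index copy (abc-iut-L5-t3 `indexCopy_not_mem_arc_of_mem_bad`, `indexCopyBad_nonempty`).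
([IUTchI] Def 6.1 (i) p.156) [claim: Mochizuki2012, status: disputed] -/
theorem nonempty_kitCore_baseKitThetaNFOfBadPairs :
    Nonempty ((BaseThetaDatum.ofKitCore (D.baseKitThetaNFOfBadPairs CG hS M hA hI B ΛBad) hl5 D.indexCopy_not_mem_arc_of_mem_bad
      D.indexCopyBad_nonempty N B' (D.evalBinderThetaNFOfBadPairs CG hS M hA hI B ΛBad hl5 ES)).KitCore
        (D.baseKitThetaNFOfBadPairs CG hS M hA hI B ΛBad)) :=
  ⟨BaseThetaDatum.KitCore.ofKit _ hl5 _ _ N B' _⟩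

open Classical in
/-- **Law (γ) `KitCore.ThetaAgrees` at `baseKitThetaNFOfBadPairs`.** ([IUTchI] Prop 6.7 p.167) [claim: Mochizuki2012, status: disputed] -/
theorem thetaAgrees_baseKitThetaNFOfBadPairs :
    (BaseThetaDatum.KitCore.ofKit (D.baseKitThetaNFOfBadPairs CG hS M hA hI B ΛBad) hl5 D.indexCopy_not_mem_arc_of_mem_bad
        D.indexCopyBad_nonempty N B' (D.evalBinderThetaNFOfBadPairs CG hS M hA hI B ΛBad hl5 ES)).ThetaAgrees
      (D.multKitThetaNFOfBadPairs CG hS M hA hI B ΛBad ES) := by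
  haveI := M.normal_PiXund_subgroupOf_PiXK
  exact D.thetaAgrees_baseKitThetaNF (D.toFlStarGlobal_surjective_of_torsionMonodromy M) D.indexCopyBad D.indexCopyArc
    (D.localDataOfBadPairs CG hS M hA hI B ΛBad) ES hl5 _ _ N B'

end Slots

section SlotsStandIn

variable (hl5 : 5 ≤ l)

/-- The local data of the Θ-NF stand-in kit. ([IUTchI] Def 6.1 (ii) p.156) [claim: Mochizuki2012, status: disputed] -/
abbrev localDataStandIn (v : D.IndexCopy) : D.LocalDatum CG hS :=
  D.localDataOfBadPairs CG hS M hA hI (fun v _ => D.badPairAtArrow hA v)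
    (fun v _ => D.localArrowLaw_local_of_torsionMonodromy CG hS M hA hI (D.decompAt v)) v

open Classical in
/-- The Θ-NF stand-in kit IS `baseKitThetaNFOfData` at `localDataStandIn` (definitional). ([IUTchI] Def 6.1 (ii) p.156) [claim: Mochizuki2012, status: disputed] -/
theorem baseKitThetaNFStandIn_eq :
    D.baseKitThetaNFStandIn CG hS M hA hI =
      (haveI := M.normal_PiXund_subgroupOf_PiXK
       D.baseKitThetaNFOfData CG hS (D.toFlStarGlobal_surjective_of_torsionMonodromy M) D.indexCopyBad D.indexCopyArc
        (D.localDataStandIn CG hS M hA hI)) :=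
  rfl

variable {Gv : D.IndexCopy → Subgroup (Fbar ≃ₐ[F] Fbar)}
  (ES : ∀ v, v ∈ D.indexCopyBad → EvalSectionBinder (D.localDataStandIn CG hS M hA hI v) (Gv v))

/-- **The multiplicative kit of `baseKitThetaNFStandIn` generated by evaluation sections.** ([IUTchI] Prop 6.7 p.167) [claim: Mochizuki2012, status: disputed] -/
def multKitThetaNFStandIn : (D.baseKitThetaNFStandIn CG hS M hA hI).MultKit :=
  D.multKitThetaNFOfBadPairs CG hS M hA hI _ _ ES

/-- **The FROZEN `EvalBinder` at `baseKitThetaNFStandIn`, INHABITED from `ES`.** ([IUTchI] Ex 4.4 (i) p.106) [claim: Mochizuki2012, status: disputed] -/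
def evalBinderThetaNFStandIn : (D.baseKitThetaNFStandIn CG hS M hA hI).EvalBinder :=
  D.evalBinderThetaNFOfBadPairs CG hS M hA hI _ _ hl5 ES

variable (N : (D.baseKitThetaNFStandIn CG hS M hA hI).NFKit) (B' : (D.baseKitThetaNFStandIn CG hS M hA hI).MonoBinder)

/-- **The FROZEN `KitCore` at `baseKitThetaNFStandIn` is INHABITED** — contrast `isEmpty_kitCore…StandIn…` of abc-iut-w4-d054 p456090/p456525 at the
D13 stand-in kits. ([IUTchI] Def 6.1 (i) p.156) [claim: Mochizuki2012, status: disputed] -/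
theorem nonempty_kitCore_baseKitThetaNFStandIn :
    Nonempty ((BaseThetaDatum.ofKitCore (D.baseKitThetaNFStandIn CG hS M hA hI) hl5 D.indexCopy_not_mem_arc_of_mem_bad
      D.indexCopyBad_nonempty N B' (D.evalBinderThetaNFStandIn CG hS M hA hI hl5 ES)).KitCore (D.baseKitThetaNFStandIn CG hS M hA hI)) :=
  ⟨BaseThetaDatum.KitCore.ofKit _ hl5 _ _ N B' _⟩

/-- **Law (γ) `KitCore.ThetaAgrees` at `baseKitThetaNFStandIn`.** ([IUTchI] Prop 6.7 p.167) [claim: Mochizuki2012, status: disputed] -/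
theorem thetaAgrees_baseKitThetaNFStandIn :
    (BaseThetaDatum.KitCore.ofKit (D.baseKitThetaNFStandIn CG hS M hA hI) hl5 D.indexCopy_not_mem_arc_of_mem_bad
        D.indexCopyBad_nonempty N B' (D.evalBinderThetaNFStandIn CG hS M hA hI hl5 ES)).ThetaAgrees
      (D.multKitThetaNFStandIn CG hS M hA hI ES) :=
  D.thetaAgrees_baseKitThetaNFOfBadPairs CG hS M hA hI _ _ hl5 ES N B'

end SlotsStandIn

end InitialThetaData

end BaseKitThetaNFInstances

end Literature.IUT.HodgeTheaters
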